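import Summits.Langlands.Langlands.Theorems.IrreducibilityBySelfDualityIrreducibleOffSectorOfArithmetic
import Summits.Langlands.Langlands.Theorems.IrreducibilityBySelfDualityIrreducibleOffSectorArtinType
import Literature.NumberTheory.GaloisRepresentations.FramedRepBaseChange
import HarnessLib

/-!
# `IrreducibleOffSector`: transport of the crux's conclusion along the field isomorphism `ι`
(crux stmt-Langlands-14329 `IrreducibilityBySelfDuality.IrreducibleOffSector`, line `Sketch`;
`--supports` file, STRUCTURAL: no import of the route module; continuation lead c5)

The crux quantifies over EVERY field isomorphism `ι : ℚ̄_ℓ ≃+* ℂ`.  Its conclusion at `(π, ℓ, ι)` is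
`C(ι) :≡ ∀ ρ, (∀ᶠ v, SatakeFrobCompatibleAt ι π ρ v) → ρ irreducible`, and `ι` enters only through
`ι⁻¹` applied to the Satake data (`arithFrobPolyOfSatake ι q_v 1 α = ∏_j (X - ι⁻¹(α_j⁻¹))`).  This
file records, unconditionally and for EVERY automorphic datum `π`, how `C(ι)` moves with `ι`:

* `continuous_algEquiv_padicAlgCl` — `Gal(ℚ̄_ℓ/ℚ_ℓ)` acts on `ℚ̄_ℓ` by isometries (spectral norm,
  Mathlib `spectralNorm_eq_of_equiv`), hence continuously;
* `satakeFrobCompatibleAt_baseChange_iff`, `isIrreducible_baseChange_iff` — for a continuous ring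
  automorphism `u` of `ℚ̄_ℓ`, `u ∘ ρ` (`FramedRep.baseChange u`) is compatible with `(π, ι)` iff `ρ`
  is compatible with `(π, ι ∘ u)` (`arithFrobPolyOfSatake_trans`, `Matrix.charpoly_map`), and is
  irreducible iff `ρ` is (`isIrreducible_of_semilinear_transport`);
* `conclusion_trans_of_conclusion` — **(A) COEFFICIENT TRANSPORT**: `C(ι) → C(ι ∘ u)` for every
  continuous automorphism `u`; an equivalence on `Gal(ℚ̄_ℓ/ℚ_ℓ)`-orbits (`conclusion_trans_algEquiv_iff`);
* `conclusion_of_conclusion_of_eqOn` — **(B) L-ARITHMETIC TRANSPORT**: if `e_i(t_{π,v}) ∈ E` a.e.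
  for a subfield `E ⊆ ℂ` (Buzzard–Gee Def. 3.1.4; Conj. 3.1.6 for L-algebraic `π`), then
  `C(ι₁) → C(ι₂)` whenever `ι₁⁻¹|_E = ι₂⁻¹|_E` (`satakeFrobCompatibleAt_iff_of_eqOn`);
* `conclusion_of_conclusion_of_eqOn_algEquiv`, `conclusion_forall_of_orbit_representatives` —
  **(A)+(B)**: `C(ι₁) → C(ι₂)` whenever `ι₂⁻¹|_E = u ∘ ι₁⁻¹|_E` for some `u ∈ Gal(ℚ̄_ℓ/ℚ_ℓ)`, i.e. the
  two embeddings `E → ℚ̄_ℓ` lie in one `Gal(ℚ̄_ℓ/ℚ_ℓ)`-orbit (classically: induce the same prime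
  `λ ∣ ℓ` of the Hecke field).  So for L-arithmetic `π` the `∀ ι` of the crux is the classical "for
  every `ℓ` and every `λ ∣ ℓ` of `E`", one `ι` per orbit; the WILD part of `ι` is idle.  For
  NON-arithmetic `π` nothing is claimed (cf. the ideator's obstruction note B1, NEGATIVE-SIDE.md);
* `irreducibleOffSector_conclusion_trans`, `irreducibleOffSector_conclusion_of_isLArithmetic_of_orbit`
  — the same in the crux's binder shape.

References: J.-P. Serre, *Abelian ℓ-adic representations and elliptic curves* (1968), Ch. I §2.3;
K. Buzzard, T. Gee, LMS LNS 414 (2014), §2.1, Def. 3.1.4, Conj. 3.1.6, Conj. 3.2.1; J. Neukirch,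
*Algebraic Number Theory* (1999), Ch. II (8.1)–(8.2).
-/

noncomputable section

set_option linter.dupNamespace false

open scoped NumberField Classical Polynomial Matrix
open Filter IsDedekindDomain Polynomial
open Literature.NumberTheory.Automorphic Literature.NumberTheory.GaloisRepresentations
open Summit.Langlands

namespace Summit.Langlands.Langlands.Theorems.IrreducibleOffSector

/-! ## 0. `Gal(ℚ̄_ℓ/ℚ_ℓ)` acts continuously on `ℚ̄_ℓ` -/

section PadicAut

variable {ℓ : ℕ} [Fact ℓ.Prime]

/-- **`Gal(ℚ̄_ℓ/ℚ_ℓ)` acts on `ℚ̄_ℓ` by isometries**: the norm of `ℚ̄_ℓ = PadicAlgCl ℓ` is the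
`ℚ_ℓ`-spectral norm, invariant under `ℚ_ℓ`-algebra automorphisms (Mathlib `spectralNorm_eq_of_equiv`;
uniqueness of the extension of a complete valuation). [cite: NeukirchANT1999, Ch. II (7.12)–(7.13)] -/
theorem norm_algEquiv_padicAlgCl (u : PadicAlgCl ℓ ≃ₐ[ℚ_[ℓ]] PadicAlgCl ℓ) (x : PadicAlgCl ℓ) :
    ‖u x‖ = ‖x‖ := by
  rw [← PadicAlgCl.spectralNorm_eq, ← PadicAlgCl.spectralNorm_eq, ← spectralNorm_eq_of_equiv]

/-- **A `ℚ_ℓ`-algebra automorphism of `ℚ̄_ℓ` is continuous** (an isometry). [folklore] -/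
theorem continuous_algEquiv_padicAlgCl (u : PadicAlgCl ℓ ≃ₐ[ℚ_[ℓ]] PadicAlgCl ℓ) : Continuous u :=
  (AddMonoidHomClass.isometry_of_norm u (norm_algEquiv_padicAlgCl u)).continuous

/-- Continuity of the underlying ring isomorphism of `u ∈ Gal(ℚ̄_ℓ/ℚ_ℓ)`. [folklore] -/
theorem continuous_toRingEquiv_algEquiv_padicAlgCl (u : PadicAlgCl ℓ ≃ₐ[ℚ_[ℓ]] PadicAlgCl ℓ) :
    Continuous (u : PadicAlgCl ℓ ≃+* PadicAlgCl ℓ) := continuous_algEquiv_padicAlgCl u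

/-- Continuity of the inverse ring isomorphism of `u ∈ Gal(ℚ̄_ℓ/ℚ_ℓ)`. [folklore] -/
theorem continuous_toRingEquiv_symm_algEquiv_padicAlgCl (u : PadicAlgCl ℓ ≃ₐ[ℚ_[ℓ]] PadicAlgCl ℓ) :
    Continuous (u : PadicAlgCl ℓ ≃+* PadicAlgCl ℓ).symm := continuous_algEquiv_padicAlgCl u.symm

end PadicAut

/-! ## 1. The predicted Frobenius polynomial under `ι ↦ ι ∘ u` -/

section FrobPoly

variable {ℓ : ℕ} [Fact ℓ.Prime]

/-- **`arithFrobPolyOfSatake (ι ∘ u) = u⁻¹(arithFrobPolyOfSatake ι)`**: for a ring automorphism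
`u` of `ℚ̄_ℓ` and `u.trans ι : x ↦ ι (u x)`, the predicted polynomial `∏ (X - (ι ∘ u)⁻¹(·))` is
`u⁻¹` applied coefficientwise to `∏ (X - ι⁻¹(·))` (both are `(ι ∘ u)⁻¹ = u⁻¹ ∘ ι⁻¹` of one complex
polynomial, `arithFrobPolyOfSatake_eq_map_symm`). [cite: BuzzardGeeLMS2014, §2.1] -/
theorem arithFrobPolyOfSatake_trans (u : PadicAlgCl ℓ ≃+* PadicAlgCl ℓ) (ι : PadicAlgCl ℓ ≃+* ℂ)
    (q m : ℕ) (α : Multiset ℂ) :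
    arithFrobPolyOfSatake (u.trans ι) q m α =
      (arithFrobPolyOfSatake ι q m α).map (u.symm : PadicAlgCl ℓ →+* PadicAlgCl ℓ) := by
  simp only [arithFrobPolyOfSatake, Polynomial.map_multiset_prod, Multiset.map_map]
  congr 1
  refine Multiset.map_congr rfl fun a _ => ?_
  simp only [Function.comp_apply, Polynomial.map_sub, Polynomial.map_X, Polynomial.map_C,
    RingEquiv.coe_toRingHom, RingEquiv.symm_trans_apply]

/-- The same read backwards: `u (arithFrobPolyOfSatake (ι ∘ u)) = arithFrobPolyOfSatake ι`. [folklore] -/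
theorem map_arithFrobPolyOfSatake_trans (u : PadicAlgCl ℓ ≃+* PadicAlgCl ℓ) (ι : PadicAlgCl ℓ ≃+* ℂ)
    (q m : ℕ) (α : Multiset ℂ) :
    (arithFrobPolyOfSatake (u.trans ι) q m α).map (u : PadicAlgCl ℓ →+* PadicAlgCl ℓ) =
      arithFrobPolyOfSatake ι q m α := by
  rw [arithFrobPolyOfSatake_trans, Polynomial.map_map]
  convert Polynomial.map_id using 2
  ext x
  simp

end FrobPoly

/-! ## 2. Coefficient transport of framed representations along a continuous automorphism -/

section Coeff

variable {ℓ : ℕ} [Fact ℓ.Prime] {K : Type} [Field K] [NumberField K] {n : ℕ}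
  {hcpt : isCompact_glFiniteIntegralLevel n K}

/-- **Compatibility under coefficient transport.**  For a continuous ring automorphism `u` of
`ℚ̄_ℓ`, the transport `u ∘ ρ` (`FramedRep.baseChange u`) is Satake–Frobenius compatible with
`(π, ι)` at `v` iff `ρ` is Satake–Frobenius compatible with `(π, ι ∘ u)` at `v`: the Satake clause
is untouched, unramifiedness is invariant (`isUnramifiedAt_baseChange_iff`), and
`charpoly (u ∘ ρ)(Frob) = u(charpoly ρ(Frob))` (`hasFrobCharpolyAt_baseChange_iff`) is
`arithFrobPolyOfSatake ι` iff `charpoly ρ(Frob)` is `u⁻¹` of it, i.e. `arithFrobPolyOfSatake (ι ∘ u)`.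
[cite: SerreAbelianLadic1968, Ch. I §2.3] -/
theorem satakeFrobCompatibleAt_baseChange_iff (u : PadicAlgCl ℓ ≃+* PadicAlgCl ℓ)
    (hu : Continuous u) (ι : PadicAlgCl ℓ ≃+* ℂ)
    (π : AutomorphicRepData (AutomorphyDatum.gl n K hcpt)) (ρ : FramedGaloisRep K (PadicAlgCl ℓ) n)
    (v : HeightOneSpectrum (𝓞 K)) :
    SatakeFrobCompatibleAt ι π (FramedRep.baseChange (u : PadicAlgCl ℓ →+* PadicAlgCl ℓ) hu ρ) v ↔
      SatakeFrobCompatibleAt (u.trans ι) π ρ v := by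
  refine exists_congr fun α => and_congr_right fun _ => and_congr ?_ ?_
  · exact FramedGaloisRep.isUnramifiedAt_baseChange_iff _ hu u.injective v ρ
  · rw [← map_arithFrobPolyOfSatake_trans u ι]
    exact FramedGaloisRep.hasFrobCharpolyAt_baseChange_iff _ hu u.injective v ρ _

omit [NumberField K] in
/-- **Irreducibility under coefficient transport.**  For a continuous ring automorphism `u` of
`ℚ̄_ℓ`, `u ∘ ρ` is irreducible iff `ρ` is: the `u`-semilinear bijection `x ↦ u ∘ x` of `ℚ̄_ℓⁿ`
intertwines `ρ` and `u ∘ ρ` (`RingHom.map_mulVec`), so stable subspaces correspond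
(`isIrreducible_of_semilinear_transport`, both ways). [cite: SerreAbelianLadic1968, Ch. I §2.3] -/
theorem isIrreducible_baseChange_iff (u : PadicAlgCl ℓ ≃+* PadicAlgCl ℓ) (hu : Continuous u)
    (ρ : FramedGaloisRep K (PadicAlgCl ℓ) n) :
    (FramedGaloisRep.toGaloisRep
        (FramedRep.baseChange (u : PadicAlgCl ℓ →+* PadicAlgCl ℓ) hu ρ :
          FramedGaloisRep K (PadicAlgCl ℓ) n)).IsIrreducible ↔
      ρ.toGaloisRep.IsIrreducible := by
  set ρ' : FramedGaloisRep K (PadicAlgCl ℓ) n :=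
    FramedRep.baseChange (u : PadicAlgCl ℓ →+* PadicAlgCl ℓ) hu ρ with hρ'
  -- the intertwining relations, in both directions
  have hfwd : ∀ (g : Field.absoluteGaloisGroup K) (x : Fin n → PadicAlgCl ℓ),
      ρ'.toRepresentation g ((u : PadicAlgCl ℓ → PadicAlgCl ℓ) ∘ x) =
        (u : PadicAlgCl ℓ → PadicAlgCl ℓ) ∘ ρ.toRepresentation g x := by
    intro g x
    funext i
    have h := RingHom.map_mulVec (u : PadicAlgCl ℓ →+* PadicAlgCl ℓ)
      ((ρ g : GL (Fin n) (PadicAlgCl ℓ)) : Matrix (Fin n) (Fin n) (PadicAlgCl ℓ)) x i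
    simp only [RingEquiv.coe_toRingHom] at h
    simp only [FramedRep.toRepresentation_apply_apply, hρ', FramedRep.coe_baseChange_apply,
      Function.comp_apply, RingEquiv.coe_toRingHom]
    exact h.symm
  have hbwd : ∀ (g : Field.absoluteGaloisGroup K) (x : Fin n → PadicAlgCl ℓ),
      ρ.toRepresentation g ((u.symm : PadicAlgCl ℓ → PadicAlgCl ℓ) ∘ x) =
        (u.symm : PadicAlgCl ℓ → PadicAlgCl ℓ) ∘ ρ'.toRepresentation g x := by
    intro g x
    have h := hfwd g ((u.symm : PadicAlgCl ℓ → PadicAlgCl ℓ) ∘ x)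
    have e1 : (u : PadicAlgCl ℓ → PadicAlgCl ℓ) ∘ ((u.symm : PadicAlgCl ℓ → PadicAlgCl ℓ) ∘ x) = x := by
      funext i; simp
    rw [e1] at h
    rw [h]
    funext i
    simp
  constructor
  · intro h'
    exact isIrreducible_of_semilinear_transport (u.symm : PadicAlgCl ℓ ≃+* PadicAlgCl ℓ)
      (ρA := ρ'.toRepresentation) (ρB := ρ.toRepresentation) hbwd h'
  · intro h
    exact isIrreducible_of_semilinear_transport (u : PadicAlgCl ℓ ≃+* PadicAlgCl ℓ)
      (ρA := ρ.toRepresentation) (ρB := ρ'.toRepresentation) hfwd h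

/-- **(A) COEFFICIENT TRANSPORT of the crux's conclusion.**  Fix `π` (any automorphic datum on
`GL_n(𝔸_K)`), `ℓ` and `ι`.  If every `ρ` Satake–Frobenius compatible with `(π, ι)` at almost all
places is irreducible, then for every CONTINUOUS ring automorphism `u` of `ℚ̄_ℓ` every `ρ` compatible
with `(π, ι ∘ u)` at almost all places is irreducible: `u ∘ ρ` is compatible with `(π, ι)`, hence
irreducible, hence so is `ρ`. [cite: BuzzardGeeLMS2014, Conj. 3.2.1] -/
theorem conclusion_trans_of_conclusion (u : PadicAlgCl ℓ ≃+* PadicAlgCl ℓ) (hu : Continuous u)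
    (ι : PadicAlgCl ℓ ≃+* ℂ) (π : AutomorphicRepData (AutomorphyDatum.gl n K hcpt))
    (h : ∀ ρ : FramedGaloisRep K (PadicAlgCl ℓ) n,
      (∀ᶠ v : HeightOneSpectrum (𝓞 K) in cofinite, SatakeFrobCompatibleAt ι π ρ v) →
        ρ.toGaloisRep.IsIrreducible)
    (ρ : FramedGaloisRep K (PadicAlgCl ℓ) n)
    (hρ : ∀ᶠ v : HeightOneSpectrum (𝓞 K) in cofinite, SatakeFrobCompatibleAt (u.trans ι) π ρ v) :
    ρ.toGaloisRep.IsIrreducible :=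
  (isIrreducible_baseChange_iff u hu ρ).1
    (h _ (hρ.mono fun v hv => (satakeFrobCompatibleAt_baseChange_iff u hu ι π ρ v).2 hv))

/-- `u.symm.trans (u.trans ι) = ι`. [folklore] -/
theorem symm_trans_trans (u : PadicAlgCl ℓ ≃+* PadicAlgCl ℓ) (ι : PadicAlgCl ℓ ≃+* ℂ) :
    u.symm.trans (u.trans ι) = ι := RingEquiv.ext fun x => by simp

/-- **Coefficient transport, `Gal(ℚ̄_ℓ/ℚ_ℓ)` form (an equivalence).**  For `u ∈ Gal(ℚ̄_ℓ/ℚ_ℓ)`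
(automatically continuous, `continuous_algEquiv_padicAlgCl`) the crux's conclusion holds at `ι` iff
it holds at `ι ∘ u`: the conclusion is constant on the `Gal(ℚ̄_ℓ/ℚ_ℓ)`-orbit of `ι`.
[cite: BuzzardGeeLMS2014, Conj. 3.2.1] -/
theorem conclusion_trans_algEquiv_iff (u : PadicAlgCl ℓ ≃ₐ[ℚ_[ℓ]] PadicAlgCl ℓ)
    (ι : PadicAlgCl ℓ ≃+* ℂ) (π : AutomorphicRepData (AutomorphyDatum.gl n K hcpt)) :
    (∀ ρ : FramedGaloisRep K (PadicAlgCl ℓ) n,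
      (∀ᶠ v : HeightOneSpectrum (𝓞 K) in cofinite, SatakeFrobCompatibleAt ι π ρ v) →
        ρ.toGaloisRep.IsIrreducible) ↔
    (∀ ρ : FramedGaloisRep K (PadicAlgCl ℓ) n,
      (∀ᶠ v : HeightOneSpectrum (𝓞 K) in cofinite,
        SatakeFrobCompatibleAt ((u : PadicAlgCl ℓ ≃+* PadicAlgCl ℓ).trans ι) π ρ v) →
        ρ.toGaloisRep.IsIrreducible) := by
  constructor
  · exact fun h ρ hρ =>
      conclusion_trans_of_conclusion _ (continuous_toRingEquiv_algEquiv_padicAlgCl u) ι π h ρ hρ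
  · intro h ρ hρ
    refine conclusion_trans_of_conclusion (u : PadicAlgCl ℓ ≃+* PadicAlgCl ℓ).symm
      (continuous_toRingEquiv_symm_algEquiv_padicAlgCl u) _ π h ρ ?_
    rwa [symm_trans_trans]

end Coeff

/-! ## 3. L-arithmetic `π`: the conclusion depends on `ι` only through `ι⁻¹|_E` -/

section Arithmetic

variable {ℓ : ℕ} [Fact ℓ.Prime]

/-- `∏_{a ∈ α} (X - C (ι⁻¹ a⁻¹)) = ι⁻¹(∏_{a ∈ α} (X - C a⁻¹))` coefficientwise. [folklore] -/
theorem arithFrobPolyOfSatake_one_eq_map (ι : PadicAlgCl ℓ ≃+* ℂ) (q : ℕ) (α : Multiset ℂ) :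
    arithFrobPolyOfSatake ι q 1 α =
      ((α.map fun a => X - C a⁻¹).prod).map (ι.symm : ℂ →+* PadicAlgCl ℓ) := by
  rw [arithFrobPolyOfSatake_one, Polynomial.map_multiset_prod, Multiset.map_map]
  congr 1
  refine Multiset.map_congr rfl fun a _ => ?_
  simp only [Function.comp_apply, Polynomial.map_sub, Polynomial.map_X, Polynomial.map_C,
    RingEquiv.coe_toRingHom]

/-- **Two `ι` agreeing on the Hecke field predict the same Frobenius polynomial.**  If the
elementary symmetric functions of the non-zero multiset `α` lie in the subfield `E ⊆ ℂ` and
`ι₁⁻¹ = ι₂⁻¹` on `E`, then `arithFrobPolyOfSatake ι₁ q 1 α = arithFrobPolyOfSatake ι₂ q 1 α`: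
the complex polynomial `∏ (X - α_j⁻¹)` has coefficients in `E`
(`exists_polynomial_map_subtype_eq_prod_X_sub_C_inv`, reciprocal Vieta).
[cite: BuzzardGeeLMS2014, Def. 3.1.4] -/
theorem arithFrobPolyOfSatake_one_eq_of_eqOn (ι₁ ι₂ : PadicAlgCl ℓ ≃+* ℂ) (E : Subfield ℂ)
    (hι : ∀ x ∈ E, ι₁.symm x = ι₂.symm x) (q : ℕ) {α : Multiset ℂ} (hne : ∀ a ∈ α, a ≠ 0)
    (hE : ∀ i ≤ Multiset.card α, α.esymm i ∈ E) :
    arithFrobPolyOfSatake ι₁ q 1 α = arithFrobPolyOfSatake ι₂ q 1 α := by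
  obtain ⟨P, hP⟩ := exists_polynomial_map_subtype_eq_prod_X_sub_C_inv E hne hE
  rw [arithFrobPolyOfSatake_one_eq_map, arithFrobPolyOfSatake_one_eq_map, ← hP, Polynomial.map_map,
    Polynomial.map_map]
  congr 1
  refine RingHom.ext fun x => ?_
  simp only [RingHom.coe_comp, Function.comp_apply, RingEquiv.coe_toRingHom]
  exact hι _ x.2

variable {K : Type} [Field K] [NumberField K] {n : ℕ} {hcpt : isCompact_glFiniteIntegralLevel n K}

/-- **Compatibility at `v` depends on `ι` only through `ι⁻¹|_E`** when the unramified Hecke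
eigenvalues `e_i(t_{π,v})` at `v` lie in `E` (Satake parameters are non-zero,
`hasSatakeParamAt_ne_zero_holds`, of cardinality `n`, `HasSatakeParamAt.card_eq`).
[cite: BuzzardGeeLMS2014, Def. 3.1.4 and Conj. 3.2.1] -/
theorem satakeFrobCompatibleAt_iff_of_eqOn (ι₁ ι₂ : PadicAlgCl ℓ ≃+* ℂ) (E : Subfield ℂ)
    (hι : ∀ x ∈ E, ι₁.symm x = ι₂.symm x) (π : AutomorphicRepData (AutomorphyDatum.gl n K hcpt))
    (ρ : FramedGaloisRep K (PadicAlgCl ℓ) n) {v : HeightOneSpectrum (𝓞 K)}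
    (hEv : ∀ α : Multiset ℂ, π.HasSatakeParamAt v α → ∀ i ≤ n, α.esymm i ∈ E) :
    SatakeFrobCompatibleAt ι₁ π ρ v ↔ SatakeFrobCompatibleAt ι₂ π ρ v := by
  refine exists_congr fun α => ?_
  constructor
  · rintro ⟨hα, hur, hcp⟩
    refine ⟨hα, hur, ?_⟩
    rwa [← arithFrobPolyOfSatake_one_eq_of_eqOn ι₁ ι₂ E hι v.residueCard
      (hasSatakeParamAt_ne_zero_holds hα) (fun i hi => hEv α hα i (hα.card_eq ▸ hi))]
  · rintro ⟨hα, hur, hcp⟩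
    refine ⟨hα, hur, ?_⟩
    rwa [arithFrobPolyOfSatake_one_eq_of_eqOn ι₁ ι₂ E hι v.residueCard
      (hasSatakeParamAt_ne_zero_holds hα) (fun i hi => hEv α hα i (hα.card_eq ▸ hi))]

/-- **(B) L-ARITHMETIC TRANSPORT of the crux's conclusion.**  Let `π` be L-arithmetic over the
subfield `E ⊆ ℂ` at almost all places (`e_i(t_{π,v}) ∈ E` for `i ≤ n`; Buzzard–Gee Def. 3.1.4 at
the unramified places — a theorem of Clozel for regular algebraic `π` through the C-algebraic
twist, Conjecture 3.1.6 for L-algebraic `π` in general).  If `ι₁⁻¹ = ι₂⁻¹` on `E` and every `ρ`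
compatible with `(π, ι₁)` a.e. is irreducible, then every `ρ` compatible with `(π, ι₂)` a.e. is
irreducible: a.e. the two compatibility predicates coincide.  The conclusion of the crux thus
depends on `ι` only through the embedding `ι⁻¹|_E : E → ℚ̄_ℓ`.
[cite: BuzzardGeeLMS2014, Def. 3.1.4 and Conj. 3.1.6] -/
theorem conclusion_of_conclusion_of_eqOn (ι₁ ι₂ : PadicAlgCl ℓ ≃+* ℂ) (E : Subfield ℂ)
    (hι : ∀ x ∈ E, ι₁.symm x = ι₂.symm x) (π : AutomorphicRepData (AutomorphyDatum.gl n K hcpt))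
    (hE : ∀ᶠ v : HeightOneSpectrum (𝓞 K) in cofinite, ∀ α : Multiset ℂ, π.HasSatakeParamAt v α →
      ∀ i ≤ n, α.esymm i ∈ E)
    (h : ∀ ρ : FramedGaloisRep K (PadicAlgCl ℓ) n,
      (∀ᶠ v : HeightOneSpectrum (𝓞 K) in cofinite, SatakeFrobCompatibleAt ι₁ π ρ v) →
        ρ.toGaloisRep.IsIrreducible)
    (ρ : FramedGaloisRep K (PadicAlgCl ℓ) n)
    (hρ : ∀ᶠ v : HeightOneSpectrum (𝓞 K) in cofinite, SatakeFrobCompatibleAt ι₂ π ρ v) :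
    ρ.toGaloisRep.IsIrreducible :=
  h ρ ((hρ.and hE).mono fun _ hv =>
    (satakeFrobCompatibleAt_iff_of_eqOn ι₁ ι₂ E hι π ρ hv.2).2 hv.1)

/-- **(A)+(B): one `ι` per `Gal(ℚ̄_ℓ/ℚ_ℓ)`-orbit of embeddings of the Hecke field suffices.**  Let
`π` be L-arithmetic over `E ⊆ ℂ` at almost all places, and let `ι₁, ι₂ : ℚ̄_ℓ ≃+* ℂ` be such that
the embeddings `ι₁⁻¹|_E, ι₂⁻¹|_E : E → ℚ̄_ℓ` differ by an element `u ∈ Gal(ℚ̄_ℓ/ℚ_ℓ)`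
(`ι₂⁻¹ x = u (ι₁⁻¹ x)` for `x ∈ E`; classically: they induce the same prime `λ ∣ ℓ` of `E`).  If
every `ρ` compatible with `(π, ι₁)` a.e. is irreducible, so is every `ρ` compatible with `(π, ι₂)`
a.e.: transport `ι₁` to `ι' = ι₁ ∘ u⁻¹` by (A) (`(ι')⁻¹ = u ∘ ι₁⁻¹`), then `ι'` to `ι₂` by (B).
[cite: BuzzardGeeLMS2014, Conj. 3.1.6 and Conj. 3.2.1] [cite: NeukirchANT1999, Ch. II (8.1)–(8.2)] -/
theorem conclusion_of_conclusion_of_eqOn_algEquiv (ι₁ ι₂ : PadicAlgCl ℓ ≃+* ℂ) (E : Subfield ℂ)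
    (u : PadicAlgCl ℓ ≃ₐ[ℚ_[ℓ]] PadicAlgCl ℓ) (hι : ∀ x ∈ E, ι₂.symm x = u (ι₁.symm x))
    (π : AutomorphicRepData (AutomorphyDatum.gl n K hcpt))
    (hE : ∀ᶠ v : HeightOneSpectrum (𝓞 K) in cofinite, ∀ α : Multiset ℂ, π.HasSatakeParamAt v α →
      ∀ i ≤ n, α.esymm i ∈ E)
    (h : ∀ ρ : FramedGaloisRep K (PadicAlgCl ℓ) n,
      (∀ᶠ v : HeightOneSpectrum (𝓞 K) in cofinite, SatakeFrobCompatibleAt ι₁ π ρ v) →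
        ρ.toGaloisRep.IsIrreducible)
    (ρ : FramedGaloisRep K (PadicAlgCl ℓ) n)
    (hρ : ∀ᶠ v : HeightOneSpectrum (𝓞 K) in cofinite, SatakeFrobCompatibleAt ι₂ π ρ v) :
    ρ.toGaloisRep.IsIrreducible := by
  -- (A): the conclusion at `ι' := u⁻¹.trans ι₁`, whose inverse is `u ∘ ι₁⁻¹`
  set ι' : PadicAlgCl ℓ ≃+* ℂ := (u : PadicAlgCl ℓ ≃+* PadicAlgCl ℓ).symm.trans ι₁ with hι'
  have hA : ∀ ρ : FramedGaloisRep K (PadicAlgCl ℓ) n,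
      (∀ᶠ v : HeightOneSpectrum (𝓞 K) in cofinite, SatakeFrobCompatibleAt ι' π ρ v) →
        ρ.toGaloisRep.IsIrreducible := fun ρ hρ =>
    conclusion_trans_of_conclusion (u : PadicAlgCl ℓ ≃+* PadicAlgCl ℓ).symm
      (continuous_toRingEquiv_symm_algEquiv_padicAlgCl u) ι₁ π h ρ hρ
  -- (B): `ι'⁻¹ = ι₂⁻¹` on `E`
  refine conclusion_of_conclusion_of_eqOn ι' ι₂ E (fun x hx => ?_) π hE hA ρ hρ
  rw [hι x hx, hι']
  simp

/-- **The `∀ ι` of the crux for an L-arithmetic `π`, from orbit representatives.**  If `π` is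
L-arithmetic over `E` a.e. and `S` is any set of isomorphisms `ℚ̄_ℓ ≃+* ℂ` such that every
`ι : ℚ̄_ℓ ≃+* ℂ` has `ι⁻¹|_E` in the `Gal(ℚ̄_ℓ/ℚ_ℓ)`-orbit of `ι₁⁻¹|_E` for some `ι₁ ∈ S`, then the
crux's conclusion at every `ι₁ ∈ S` gives it at every `ι`.  (Classically `S` has one element per
prime `λ ∣ ℓ` of `E`; the hypothesis `hrep` is where the orbit/prime dictionary enters.)
[cite: BuzzardGeeLMS2014, Conj. 3.2.1] [cite: NeukirchANT1999, Ch. II (8.1)–(8.2)] -/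
theorem conclusion_forall_of_orbit_representatives (E : Subfield ℂ)
    (π : AutomorphicRepData (AutomorphyDatum.gl n K hcpt))
    (hE : ∀ᶠ v : HeightOneSpectrum (𝓞 K) in cofinite, ∀ α : Multiset ℂ, π.HasSatakeParamAt v α →
      ∀ i ≤ n, α.esymm i ∈ E)
    (S : Set (PadicAlgCl ℓ ≃+* ℂ))
    (hrep : ∀ ι : PadicAlgCl ℓ ≃+* ℂ, ∃ ι₁ ∈ S, ∃ u : PadicAlgCl ℓ ≃ₐ[ℚ_[ℓ]] PadicAlgCl ℓ,
      ∀ x ∈ E, ι.symm x = u (ι₁.symm x))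
    (hS : ∀ ι₁ ∈ S, ∀ ρ : FramedGaloisRep K (PadicAlgCl ℓ) n,
      (∀ᶠ v : HeightOneSpectrum (𝓞 K) in cofinite, SatakeFrobCompatibleAt ι₁ π ρ v) →
        ρ.toGaloisRep.IsIrreducible)
    (ι : PadicAlgCl ℓ ≃+* ℂ) (ρ : FramedGaloisRep K (PadicAlgCl ℓ) n)
    (hρ : ∀ᶠ v : HeightOneSpectrum (𝓞 K) in cofinite, SatakeFrobCompatibleAt ι π ρ v) :
    ρ.toGaloisRep.IsIrreducible := by
  obtain ⟨ι₁, hι₁, u, hu⟩ := hrep ι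
  exact conclusion_of_conclusion_of_eqOn_algEquiv ι₁ ι E u hu π hE (hS ι₁ hι₁) ρ hρ

end Arithmetic

/-! ## 4. In the binder shape of the crux -/

section OnCrux

/-- **The crux's conclusion is constant on `Gal(ℚ̄_ℓ/ℚ_ℓ)`-orbits of `ι`** (binder shape of
`IrreducibleOffSector`, every `n`, `K`, `π`; the cuspidality / L-algebraicity / off-sector
hypotheses are carried, not used). [cite: BuzzardGeeLMS2014, Conj. 3.2.1] -/
theorem irreducibleOffSector_conclusion_trans
    (n : ℕ) (K : Type) [Field K] [NumberField K] (hcpt : isCompact_glFiniteIntegralLevel n K)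
    (π : CuspidalAutomorphicRepData n K hcpt) (ℓ : ℕ) [Fact ℓ.Prime] (ι : PadicAlgCl ℓ ≃+* ℂ)
    (hι : ∀ ρ : FramedGaloisRep K (PadicAlgCl ℓ) n,
      (∀ᶠ v : HeightOneSpectrum (𝓞 K) in cofinite, SatakeFrobCompatibleAt ι π.1 ρ v) →
        ρ.toGaloisRep.IsIrreducible)
    (u : PadicAlgCl ℓ ≃ₐ[ℚ_[ℓ]] PadicAlgCl ℓ) (ρ : FramedGaloisRep K (PadicAlgCl ℓ) n)
    (hρ : ∀ᶠ v : HeightOneSpectrum (𝓞 K) in cofinite,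
      SatakeFrobCompatibleAt ((u : PadicAlgCl ℓ ≃+* PadicAlgCl ℓ).trans ι) π.1 ρ v) :
    ρ.toGaloisRep.IsIrreducible :=
  (conclusion_trans_algEquiv_iff u ι π.1).1 hι ρ hρ

/-- **For L-arithmetic `π` the crux's `∀ ι` is "one `ι` per prime of the Hecke field"** (binder
shape): given `n, K, hcpt`, a cuspidal `π` that is L-arithmetic over a subfield `E ⊆ ℂ` at almost
all places, `ℓ`, and a set `S` of representatives (`hrep`: every `ι⁻¹|_E` is `Gal(ℚ̄_ℓ/ℚ_ℓ)`-conjugate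
to some `ι₁⁻¹|_E`, `ι₁ ∈ S`), the conclusion of `IrreducibleOffSector` at every `ι₁ ∈ S` implies it
at EVERY `ι`. [cite: BuzzardGeeLMS2014, Conj. 3.1.6 and Conj. 3.2.1] -/
theorem irreducibleOffSector_conclusion_of_isLArithmetic_of_orbit
    (n : ℕ) (K : Type) [Field K] [NumberField K] (hcpt : isCompact_glFiniteIntegralLevel n K)
    (π : CuspidalAutomorphicRepData n K hcpt) (E : Subfield ℂ)
    (hE : ∀ᶠ v : HeightOneSpectrum (𝓞 K) in cofinite, ∀ α : Multiset ℂ, π.1.HasSatakeParamAt v α →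
      ∀ i ≤ n, α.esymm i ∈ E)
    (ℓ : ℕ) [Fact ℓ.Prime] (S : Set (PadicAlgCl ℓ ≃+* ℂ))
    (hrep : ∀ ι : PadicAlgCl ℓ ≃+* ℂ, ∃ ι₁ ∈ S, ∃ u : PadicAlgCl ℓ ≃ₐ[ℚ_[ℓ]] PadicAlgCl ℓ,
      ∀ x ∈ E, ι.symm x = u (ι₁.symm x))
    (hS : ∀ ι₁ ∈ S, ∀ ρ : FramedGaloisRep K (PadicAlgCl ℓ) n,
      (∀ᶠ v : HeightOneSpectrum (𝓞 K) in cofinite, SatakeFrobCompatibleAt ι₁ π.1 ρ v) →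
        ρ.toGaloisRep.IsIrreducible) :
    ∀ (ι : PadicAlgCl ℓ ≃+* ℂ) (ρ : FramedGaloisRep K (PadicAlgCl ℓ) n),
      (∀ᶠ v : HeightOneSpectrum (𝓞 K) in cofinite, SatakeFrobCompatibleAt ι π.1 ρ v) →
        ρ.toGaloisRep.IsIrreducible :=
  fun ι ρ hρ => conclusion_forall_of_orbit_representatives E π.1 hE S hrep hS ι ρ hρ

end OnCrux

end Summit.Langlands.Langlands.Theorems.IrreducibleOffSector

end
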